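import Summits.ResolutionOfSingularities.ResolutionOfSingularities.Theorems.FrobeniusLadderFRationalResolutionEtaleChartExtraction
import HarnessLib

/-!
# Crux `FrobeniusLadder.FRationalResolution` (stmt-ResolutionOfSingularities-15317), line `redirect`,
# stub `stub_diagonalizableQuotientResolution` — **ring data from an ÉTALE ROOF** (brick P7-c3′ of memo
# MEMO-15317-leafhand2-g8 §8–§9, extraction half; generalises the extraction steps (1)–(4) of
# `…EtaleChartExtraction.hloc_of_etale_chart_pointBlowup` from "an étale chart" to "an étale roof
# `X ← Y ↪ Spec C`", the currency in which the point-blow-up recursion for the SURFACE CASE passes its chart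
# algebras from one round to the next)

* `map_comp_eq_maximalIdeal_of_etale` — for an étale ring map `φ : B → C` and primes `𝔔 ∩ B = 𝔭`:
  `𝔭 C_𝔔 = 𝔪_{C_𝔔}` (Mathlib `Algebra.isUnramifiedAt_iff_map_eq`, packaged for bare ring homs);
* `map_map_le_of_comap_eq` — an inclusion `𝔓 C_𝔓 ≤ J C_𝔓` transports along any `l : C → C'` to a prime `𝔔`
  over `𝔓`: `(𝔓C') C'_𝔔 ≤ (JC') C'_𝔔` (`Localization.localRingHom`);
* **`exists_affine_ring_data`** — `X` integral, locally of finite type over `k`, finitely many singular points;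
  a roof `ρ : Y → X` étale, `j : Y → Spec C` an open immersion, `y ∈ Y` with `ρ y` singular. Then there are an affine
  open `U ∋ ρ y` meeting no other singular point (with its `k`-algebra structure, `Γ(X,U)` a domain of finite type,
  the point's prime `𝔭` maximal and nonzero, all other points of `Spec Γ(X,U)` regular), a ring `C'`, an ÉTALE
  `φ : Γ(X,U) → C'`, an `l : C → C'` with `Spec l` an OPEN IMMERSION, and a prime `𝔔 ⊆ C'` with `𝔔 ∩ Γ(X,U) = 𝔭`
  and `𝔔 ∩ C = j(y)` (namely `C' = Γ(Y, V)` for `V = j⁻¹ D(G) ⊆ ρ⁻¹ U`).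

Honest label: scheme plumbing toward ONE leaf stub (no stub, crux or summit closed). No definitions, no named facts,
no sorry. [folklore; cite: Kollar2007, §2.2] [cite: GortzWedhorn2020, Prop. 13.91]
-/

noncomputable section

-- single-problem summit: the doubled namespace component is forced
set_option linter.dupNamespace false

open CategoryTheory AlgebraicGeometry TopologicalSpace
open Literature.AlgebraicGeometry.Resolution

namespace Summit.ResolutionOfSingularities.ResolutionOfSingularities.Theorems.FRationalResolution.EtaleRoofExtraction

/-- **Étale ring maps are unramified at every prime**: `𝔭 C_𝔔 = 𝔪_{C_𝔔}` for `𝔔 ∩ B = 𝔭`.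
[cite: StacksProject, Tag 02GL] -/
theorem map_comp_eq_maximalIdeal_of_etale {B C : Type} [CommRing B] [CommRing C] (φ : B →+* C)
    (hφ : φ.Etale) (𝔭 : Ideal B) [𝔭.IsPrime] (𝔔 : Ideal C) [𝔔.IsPrime] (h : 𝔔.comap φ = 𝔭) :
    𝔭.map ((algebraMap C (Localization.AtPrime 𝔔)).comp φ) =
      IsLocalRing.maximalIdeal (Localization.AtPrime 𝔔) := by
  letI : Algebra B C := φ.toAlgebra
  haveI : Algebra.Etale B C := hφ
  haveI : 𝔔.LiesOver 𝔭 := ⟨by rw [Ideal.under_def]; exact h.symm⟩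
  letI := Localization.AtPrime.algebraOfLiesOver 𝔭 𝔔
  haveI : Algebra.IsUnramifiedAt B 𝔔 :=
    (Algebra.formallyUnramified_iff_forall).mp inferInstance ⟨𝔔, inferInstance⟩
  have h2 := ((Algebra.isUnramifiedAt_iff_map_eq B 𝔭 𝔔).mp inferInstance).2
  rwa [IsScalarTower.algebraMap_eq B C (Localization.AtPrime 𝔔)] at h2

/-- **Transport of `𝔓 C_𝔓 ≤ J C_𝔓` along a ring map to a prime over `𝔓`.** [folklore] -/
theorem map_map_le_of_comap_eq {C C' : Type} [CommRing C] [CommRing C'] (l : C →+* C')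
    (𝔓 : Ideal C) [𝔓.IsPrime] (𝔔 : Ideal C') [𝔔.IsPrime] (h : 𝔔.comap l = 𝔓) (J : Ideal C)
    (hJ : 𝔓.map (algebraMap C (Localization.AtPrime 𝔓)) ≤ J.map (algebraMap C (Localization.AtPrime 𝔓))) :
    (𝔓.map l).map (algebraMap C' (Localization.AtPrime 𝔔)) ≤
      (J.map l).map (algebraMap C' (Localization.AtPrime 𝔔)) := by
  set L := Localization.localRingHom 𝔓 𝔔 l h.symm with hL
  have hcomp : L.comp (algebraMap C (Localization.AtPrime 𝔓)) = (algebraMap C' (Localization.AtPrime 𝔔)).comp l :=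
    RingHom.ext fun x => by simp [hL, Localization.localRingHom_to_map]
  have key := Ideal.map_mono (f := L) hJ
  rw [Ideal.map_map, Ideal.map_map, hcomp, ← Ideal.map_map, ← Ideal.map_map] at key
  exact key

/-- **Ring data from an étale roof.** See the module docstring. [cite: Kollar2007, §2.2]
[cite: GortzWedhorn2020, Prop. 13.91] -/
theorem exists_affine_ring_data (k : Type) [Field k] (X : Scheme.{0}) [IsIntegral X]
    (f : X ⟶ Spec (.of k)) [LocallyOfFiniteType f] (hfin : (Scheme.regularLocus X)ᶜ.Finite)
    {Y : Scheme.{0}} (ρ : Y ⟶ X) [Etale ρ] {C : Type} [CommRing C]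
    (j : Y ⟶ Spec (.of C)) [IsOpenImmersion j] (y : Y) (hx : ρ y ∉ Scheme.regularLocus X) :
    ∃ (U : X.Opens) (hU : IsAffineOpen U) (hxU : ρ y ∈ U) (_ : Algebra k Γ(X, U))
      (_ : Algebra.FiniteType k Γ(X, U)) (_ : IsDomain Γ(X, U))
      (C' : Type) (_ : CommRing C') (φ : Γ(X, U) →+* C') (_ : φ.Etale) (l : C →+* C')
      (_ : IsOpenImmersion (Spec.map (CommRingCat.ofHom l))) (𝔔 : Ideal C') (_ : 𝔔.IsPrime),
      hU.fromSpec ≫ f = Spec.map (CommRingCat.ofHom (algebraMap k Γ(X, U))) ∧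
      (∀ t : X, t ∉ Scheme.regularLocus X → t ∈ U → t = ρ y) ∧
      (hU.primeIdealOf ⟨ρ y, hxU⟩).asIdeal.IsMaximal ∧ (hU.primeIdealOf ⟨ρ y, hxU⟩).asIdeal ≠ ⊥ ∧
      (∀ P : Spec (.of Γ(X, U)), P.asIdeal ≠ (hU.primeIdealOf ⟨ρ y, hxU⟩).asIdeal →
        P ∈ Scheme.regularLocus (Spec (.of Γ(X, U)))) ∧
      𝔔.comap φ = (hU.primeIdealOf ⟨ρ y, hxU⟩).asIdeal ∧ 𝔔.comap l = (j y).asIdeal := by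
  classical
  set x := ρ y with hxdef
  -- (1) the other singular points form a finite set of closed points; remove them
  set T : Set X := (Scheme.regularLocus X)ᶜ \ {x} with hT
  have hTfin : T.Finite := hfin.subset Set.sdiff_subset
  have hTclosed : IsClosed T := by
    have : T = ⋃ z ∈ T, {z} := (Set.biUnion_of_singleton T).symm
    rw [this]
    exact hTfin.isClosed_biUnion fun z hz =>
      IsolatedClosed.isClosed_singleton_of_finite_singularLocus k X f hfin hz.1
  let W₀ : X.Opens := ⟨Tᶜ, hTclosed.isOpen_compl⟩
  have hxW₀ : x ∈ W₀ := fun h => h.2 rfl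
  -- (2) an affine open `U ∋ x` inside `W₀`
  obtain ⟨U, hU, hxU, hUW⟩ := exists_isAffineOpen_mem_and_subset (U := W₀) hxW₀
  haveI : Nonempty U := ⟨⟨x, hxU⟩⟩
  set ι := hU.fromSpec with hιdef
  set 𝔭 := hU.primeIdealOf ⟨x, hxU⟩ with h𝔭def
  have hι𝔭 : ι 𝔭 = x := hU.fromSpec_primeIdealOf ⟨x, hxU⟩
  have hxcl : IsClosed ({x} : Set X) := IsolatedClosed.isClosed_singleton_of_finite_singularLocus k X f hfin hx
  have h𝔭max : 𝔭.asIdeal.IsMaximal := hU.primeIdealOf_isMaximal_of_isClosed ⟨x, hxU⟩ hxcl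
  have huniq : ∀ t : X, t ∉ Scheme.regularLocus X → t ∈ U → t = x := by
    intro t ht htU
    by_contra hne
    exact hUW htU ⟨ht, hne⟩
  -- points of `Spec Γ(X,U)` other than `𝔭` are regular
  have hregB : ∀ P : Spec Γ(X, U), P.asIdeal ≠ 𝔭.asIdeal → P ∈ Scheme.regularLocus (Spec Γ(X, U)) := by
    intro P hP
    rw [mem_regularLocus_iff_of_flat_of_isPreimmersion ι]
    have hPU : ι P ∈ U := by
      have : ι P ∈ Set.range ι := ⟨P, rfl⟩
      rwa [hιdef, hU.range_fromSpec] at this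
    have hPx : ι P ≠ x := by
      intro h
      apply hP
      have : P = 𝔭 := ι.isOpenEmbedding.injective (h.trans hι𝔭.symm)
      rw [this]
    by_contra hnreg
    exact hUW hPU ⟨hnreg, hPx⟩
  -- `𝔭 ≠ 0`: otherwise `Spec Γ(X,U) = {𝔭}` and the dense regular locus would contain `x`
  have h𝔭0 : 𝔭.asIdeal ≠ ⊥ := by
    intro h0
    have hbot : (⊥ : Ideal Γ(X, U)).IsMaximal := h0 ▸ h𝔭max
    obtain ⟨t, htU, htreg⟩ := (Scheme.dense_regularLocus X).inter_open_nonempty U U.2 ⟨x, hxU⟩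
    have htr : t ∈ Set.range ι := by rw [hιdef, hU.range_fromSpec]; exact htU
    obtain ⟨P, rfl⟩ := htr
    have hP : P.asIdeal = 𝔭.asIdeal := by
      rw [h0]
      exact (hbot.eq_of_le P.isPrime.ne_top bot_le).symm
    have hP' : P = 𝔭 := PrimeSpectrum.ext hP
    rw [hP', hι𝔭] at htreg
    exact hx htreg
  -- (3) the `k`-algebra structure of `Γ(X,U)`
  obtain ⟨gk, hgk⟩ := Spec.map_surjective (ι ≫ f)
  letI : Algebra k Γ(X, U) := gk.hom.toAlgebra
  have hιf : ι ≫ f = Spec.map (CommRingCat.ofHom (algebraMap k Γ(X, U))) := by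
    rw [← hgk]; rfl
  haveI hft : Algebra.FiniteType k Γ(X, U) := by
    have h1 : LocallyOfFiniteType (Spec.map gk) := by rw [hgk]; infer_instance
    rw [HasRingHomProperty.Spec_iff (P := @LocallyOfFiniteType)] at h1
    exact h1
  -- (4) an affine open `V ∋ y` of `Y` over `U`, the preimage of a basic open `D(G)` of `Spec C`
  set Ω : Y.Opens := ρ ⁻¹ᵁ U with hΩ
  have hyΩ : y ∈ Ω := hxU
  have hjyΩ : j y ∈ j ''ᵁ Ω := (j.apply_mem_image_iff).mpr hyΩ
  obtain ⟨_, ⟨G, rfl⟩, hyG, hGΩ⟩ := (Opens.isBasis_iff_nbhd.mp PrimeSpectrum.isBasis_basic_opens) hjyΩ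
  set DG : (Spec (.of C)).Opens := PrimeSpectrum.basicOpen G with hDG
  set V : Y.Opens := j ⁻¹ᵁ DG with hVdef
  have hyV : y ∈ V := hyG
  have hGrange : DG ≤ j.opensRange := hGΩ.trans (j.image_le_opensRange Ω)
  have hV : IsAffineOpen V := by
    have hGaff : IsAffineOpen DG := by
      rw [hDG, ← basicOpen_eq_of_affine]
      exact (isAffineOpen_top (Spec (.of C))).basicOpen _
    exact hGaff.preimage_of_isOpenImmersion j hGrange
  have e : V ≤ ρ ⁻¹ᵁ U := by
    intro v hv
    have h1 : j v ∈ j ''ᵁ Ω := hGΩ hv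
    exact (j.apply_mem_image_iff).mp h1
  -- (5) the rings: `C' = Γ(Y, V)`, `φ = ρ^*`, `l = j^*`
  set ψ := ρ.appLE U V e with hψdef
  have hψ : ψ.hom.Etale := ρ.etale_appLE hU hV e
  set 𝔔 := hV.primeIdealOf ⟨y, hyV⟩ with h𝔔def
  have hcomapψ : 𝔔.asIdeal.comap ψ.hom = 𝔭.asIdeal :=
    congrArg PrimeSpectrum.asIdeal (hU.comap_primeIdealOf_appLE (f := ρ) U V hV e hyV)
  have eV : V ≤ j ⁻¹ᵁ ⊤ := le_top
  set lh := j.appLE ⊤ V eV with hlh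
  set l : C →+* Γ(Y, V) := lh.hom.comp (Scheme.ΓSpecIso (.of C)).inv.hom with hl
  have hSpecl : Spec.map (CommRingCat.ofHom l) = hV.fromSpec ≫ j := by
    have h1 : CommRingCat.ofHom l = (Scheme.ΓSpecIso (.of C)).inv ≫ lh := by rw [hl]; rfl
    rw [h1, Spec.map_comp, ← Scheme.isoSpec_Spec_inv, ← IsAffineOpen.fromSpec_top,
      IsAffineOpen.SpecMap_appLE_fromSpec j (isAffineOpen_top _) hV eV]
  have hlopen : IsOpenImmersion (Spec.map (CommRingCat.ofHom l)) := by
    rw [hSpecl]; infer_instance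
  have hcomapl : 𝔔.asIdeal.comap l = (j y).asIdeal := by
    have hpt : Spec.map (CommRingCat.ofHom l) 𝔔 = j y := by
      rw [hSpecl, Scheme.Hom.comp_apply, h𝔔def, hV.fromSpec_primeIdealOf ⟨y, hyV⟩]
    rw [← hpt]
    rfl
  refine ⟨U, hU, hxU, inferInstance, hft, inferInstance, Γ(Y, V), inferInstance, ψ.hom, hψ, l, hlopen,
    𝔔.asIdeal, 𝔔.isPrime, hιf, huniq, h𝔭max, h𝔭0, hregB, hcomapψ, hcomapl⟩

end Summit.ResolutionOfSingularities.ResolutionOfSingularities.Theorems.FRationalResolution.EtaleRoofExtraction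

end
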